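import Summits.Langlands.Langlands.Theorems.ParityBlindBianchiTwoAdicBianchiProModularityLevelSqueezeDefsHecke
import Summits.Langlands.Langlands.Theorems.ParityBlindBianchiTwoAdicBianchiProModularityLevelSqueezeAutGeneric
import HarnessLib

/-!
# Line `dimension-squeeze` (crux `TwoAdicBianchiProModularityLevel`, stmt-Langlands-15110): the automorphic stub
# from AUT-core

`stub_heckeDimension_of_autCore : AutCore → <registered signature of stub_heckeDimension (v3)>` (AutCore written out:
it is the v6 stub `stub_heckeDatum`, also recorded as `def AutCore` in the crux workfile `Lines/dimension_squeeze_PromoteAutCore.lean`) — the automorphic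
stub of the checked skeleton `Cruxes/TwoAdicBianchiProModularityLevel/Lines/dimension_squeeze.lean` follows from the
`σ`-blind AUT-core statement (`…SqueezeDefsHecke.lean`: a Hecke-algebra datum for `V(typeIdealD)` at some tame level)
by the landed reductions `squeeze_heckeDimensionOf_of_heckeAlgebra` (dense quotient + DENSITY).  With this the
composition of the line reads  E2′ ⇐ A ∧ GAL(v3) ∧ AutCore ∧ READ(v3)  with `stub_setup` proved.
[cite: GeeNewton2020, Prop. 54 and Rem. 58]
-/

noncomputable section

set_option linter.dupNamespace false -- `Summit.Langlands.Langlands` is the mandated namespace (D-0017)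

open scoped NumberField MatrixGroups
open Polynomial IsDedekindDomain Field
open Literature.NumberTheory.GaloisRepresentations Literature.NumberTheory.Automorphic

namespace Summit.Langlands.Langlands.Cruxes.TwoAdicBianchiProModularityLevel.DimensionSqueeze

/-- **A Hecke-algebra datum gives the dimension bound** `dim (R ⧸ heckeIdealOf I U) ≥ 4`
(`squeeze_heckeDimensionOf_of_heckeAlgebra` on the bundled hypotheses). [cite: GeeNewton2020, Prop. 54 and Rem. 58] -/
theorem HeckeAlgebraDatum.four_le_ringKrullDim_quotient {K : Type} [Field K] [NumberField K]
    {σ : FramedGaloisRep K (PadicAlgCl 2) 2} {M : Model σ} {S₀ : Finset ℕ} {h0 : (0 : ℕ) ∉ S₀} {h2 : 2 ∈ S₀}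
    {hunr : ∀ v ∉ badSet K S₀, Deformation.IsUnramifiedAt v M.residual}
    {𝓡 : PolarizedDeformationRing (M.datum S₀ h0 h2 hunr)} {I : Ideal 𝓡.R}
    {U : Subgroup (GL (Fin 2) (FiniteAdeleRing (𝓞 K) K))}
    {ϖ : ∀ v : HeightOneSpectrum (𝓞 K), (v.adicCompletion K)ˣ} (D : HeckeAlgebraDatum M 𝓡 I U ϖ) :
    (4 : WithBot ℕ∞) ≤ ringKrullDim (𝓡.R ⧸ M.heckeIdealOf 𝓡 I U ϖ) :=
  squeeze_heckeDimensionOf_of_heckeAlgebra K σ M S₀ h0 h2 hunr 𝓡 I U ϖ D.T D.q D.surjective D.torsionFree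
    D.points_hecke D.four_le_dim

/-- REGISTERED SUB-GOAL `stub_heckeDimension_of_autCore`: **the automorphic stub of the line follows from
AUT-core.** [cite: GeeNewton2020, Prop. 54 and Rem. 58] -/
theorem stub_heckeDimension_of_autCore :
    (∀ (K : Type) [Field K] [NumberField K], NumberField.IsTotallyComplex K → Module.finrank ℚ K = 2 →
      (∃ v w : HeightOneSpectrum (𝓞 K), v ≠ w ∧ ((2 : ℕ) : 𝓞 K) ∈ v.asIdeal ∧ ((2 : ℕ) : 𝓞 K) ∈ w.asIdeal) →
      ∀ (σ : FramedGaloisRep K (PadicAlgCl 2) 2), Finite σ.toMonoidHom.range → σ.toGaloisRep.IsIrreducible →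
      Nonempty ((Matrix.ProjGenLinGroup.mk.comp σ.toMonoidHom).range ≃* alternatingGroup (Fin 5)) →
      ∀ (S₀ : Finset ℕ) (h0 : (0 : ℕ) ∉ S₀) (h2 : 2 ∈ S₀) (ϖ : ∀ v : HeightOneSpectrum (𝓞 K), (v.adicCompletion K)ˣ), (∀ v : HeightOneSpectrum (𝓞 K), Valued.v ((ϖ v : (v.adicCompletion K)ˣ) : v.adicCompletion K) = WithZero.exp (-1 : ℤ)) →
      ∀ (a : Good K S₀ → ℕ →
      O2), (∀ (v : HeightOneSpectrum (𝓞 K)) (hv : ∀ ℓ ∈ S₀, ((ℓ : ℕ) : 𝓞 K) ∉ v.asIdeal), σ.IsHeckeAssociatedAt v (fun i : ℕ => if i = 0 then (1 : PadicAlgCl 2) else (a ⟨v, hv⟩ i : PadicAlgCl 2))) →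
      (∃ U₀ : Subgroup (GL (Fin 2) (FiniteAdeleRing (𝓞 K) K)), IsTameLevel K S₀ U₀ ∧ ∃ b : Good K S₀ → ℕ →
      O2, (∀ j : Good K S₀ × Fin 2, ‖(b j.1 (j.2.val + 1) : PadicAlgCl 2) - (a j.1 (j.2.val + 1) : PadicAlgCl 2)‖ < 1) ∧ IsPointAt K S₀ U₀ ϖ b) →
      ∀ (M : Model σ) (hunr : ∀ v ∉ badSet K S₀, Deformation.IsUnramifiedAt v M.residual) (𝓡 : PolarizedDeformationRing (M.datum S₀ h0 h2 hunr)), ∃ U : Subgroup (GL (Fin 2) (FiniteAdeleRing (𝓞 K) K)), IsTameLevel K S₀ U ∧ Nonempty (HeckeAlgebraDatum M 𝓡 (M.typeIdealD 𝓡) U ϖ)) →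
      ∀ (K : Type) [Field K] [NumberField K], NumberField.IsTotallyComplex K → Module.finrank ℚ K = 2 →
      (∃ v w : HeightOneSpectrum (𝓞 K), v ≠ w ∧ ((2 : ℕ) : 𝓞 K) ∈ v.asIdeal ∧ ((2 : ℕ) : 𝓞 K) ∈ w.asIdeal) →
      ∀ (σ : FramedGaloisRep K (PadicAlgCl 2) 2), Finite σ.toMonoidHom.range → σ.toGaloisRep.IsIrreducible →
      Nonempty ((Matrix.ProjGenLinGroup.mk.comp σ.toMonoidHom).range ≃* alternatingGroup (Fin 5)) →
      ∀ (S₀ : Finset ℕ) (h0 : (0 : ℕ) ∉ S₀) (h2 : 2 ∈ S₀) (ϖ : ∀ v : HeightOneSpectrum (𝓞 K), (v.adicCompletion K)ˣ), (∀ v : HeightOneSpectrum (𝓞 K), Valued.v ((ϖ v : (v.adicCompletion K)ˣ) : v.adicCompletion K) = WithZero.exp (-1 : ℤ)) →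
      ∀ (a : Good K S₀ → ℕ →
      O2), (∀ (v : HeightOneSpectrum (𝓞 K)) (hv : ∀ ℓ ∈ S₀, ((ℓ : ℕ) : 𝓞 K) ∉ v.asIdeal), σ.IsHeckeAssociatedAt v (fun i : ℕ => if i = 0 then (1 : PadicAlgCl 2) else (a ⟨v, hv⟩ i : PadicAlgCl 2))) →
      (∃ U₀ : Subgroup (GL (Fin 2) (FiniteAdeleRing (𝓞 K) K)), IsTameLevel K S₀ U₀ ∧ ∃ b : Good K S₀ → ℕ →
      O2, (∀ j : Good K S₀ × Fin 2, ‖(b j.1 (j.2.val + 1) : PadicAlgCl 2) - (a j.1 (j.2.val + 1) : PadicAlgCl 2)‖ < 1) ∧ IsPointAt K S₀ U₀ ϖ b) →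
      ∀ (M : Model σ) (hunr : ∀ v ∉ badSet K S₀, Deformation.IsUnramifiedAt v M.residual) (𝓡 : PolarizedDeformationRing (M.datum S₀ h0 h2 hunr)), ∃ U : Subgroup (GL (Fin 2) (FiniteAdeleRing (𝓞 K) K)), IsTameLevel K S₀ U ∧ (4 : WithBot ℕ∞) ≤ ringKrullDim (𝓡.R ⧸ M.heckeIdealOf 𝓡 (M.typeIdealD 𝓡) U ϖ) := by
  intro hcore K _ _ htc hdeg hsplit σ hfin hirr hA5 S₀ h0 h2 ϖ hϖ a hassoc hocc M hunr 𝓡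
  obtain ⟨U, hU, ⟨D⟩⟩ := hcore K htc hdeg hsplit σ hfin hirr hA5 S₀ h0 h2 ϖ hϖ a hassoc hocc M hunr 𝓡
  exact ⟨U, hU, D.four_le_ringKrullDim_quotient⟩

end Summit.Langlands.Langlands.Cruxes.TwoAdicBianchiProModularityLevel.DimensionSqueeze

end
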